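import Mathlib
import Summits.Parity.BatemanHorn.Theorems.IsogenyRedeiTypeIMainTermComponents
import Summits.Parity.BatemanHorn.Theorems.IsogenyRedeiPolyMobiusTailStubSignedTypeIOfKernel
import Summits.Parity.BatemanHorn.Theorems.IsogenyRedeiPolyMobiusTailStubKernelSumEq
import Summits.Parity.BatemanHorn.Theorems.IsogenyRedeiPolyMobiusTailStubStripCore
import Summits.Parity.BatemanHorn.Theorems.IsogenyRedeiPolyMobiusTailStubTupleRootCountMean
import Summits.Parity.BatemanHorn.Theorems.IsogenyRedeiPolyMobiusTailKernelTwoLe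
import Summits.Parity.BatemanHorn.Theorems.IsogenyRedeiPolyMobiusTailStripTwoLeAux

/-!
# Crux `PolyMobiusTail` (stmt-Parity-0870), line `Sketch`: the registered stub `stub_strip_two_le`

Lead prover `prover-line-stmt-Parity-0870-c1-0`. THE STRIP for `k ≥ 2`: for a Bateman–Horn system and
`η ∈ (1/2, 1)` the natural tail between the cut-offs `x^{1-η}` and `x/(log x)^{2k+2}` sums to `o(x)`.
Assembly (skeleton v6): `T`-expansion (`StripTwoLeAux.truncated_natural_expand`); per `T` the landed
`stub_strip_core` (swap + period, exact counts) and `stub_tuple_rootCount_mean` (`R(y) ≪ y (log y)^k`) make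
both approximation errors `o(x)`; for `T ≠ ∅` the kernel for every `k` (`KernelTwoLe.kernel_of_stubs`) bounds the main term at `y₂ = x/(log x)^{2k+2}` by `≪ x/log x` and the landed signed
Type-I bookkeeping handles `y₁ = x^{1-η}`; for `T = ∅` the log-weighted singular series
`V_∅(y) = Σ_{m≤⌊y⌋} [ε_univ] 𝒶(m)` (`stub_kernel_sum_eq`) converges (`tendsto_sum_coeff_univ_aFun`). Everything here is proved.
-/

open scoped BigOperators Topology
open Filter Finset Polynomial Asymptotics

namespace Summit.Parity.BatemanHorn.Theorems.PolyMobiusTail.NaturalForm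

open Literature.NumberTheory.Sieve
open Summit.Parity.BatemanHorn.Theorems.TypeIMainTerm

namespace StripTwoLe

section PerT

variable {k : ℕ} (f : Fin k → ℤ[X]) (T : Finset (Fin k)) (N₀ : ℕ)

/-- Growth of `X_T(x) = Σ_{N₀≤n≤x} ∏_{i∈T} log fᵢ(n)`: `0 ≤ X_T(x) ≤ x (K log x)^{|T|}` for `x ≥ N₀ ≥ 3`. [folklore] -/
theorem weight_sum_le (hN₀3 : 3 ≤ N₀)
    (h2 : ∀ n : ℕ, N₀ ≤ n → ∀ i, 2 ≤ ((f i).eval (n : ℤ)).toNat)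
    (hmono : ∀ i (m n : ℕ), N₀ ≤ m → m ≤ n → (f i).eval (m : ℤ) ≤ (f i).eval (n : ℤ)) :
    ∃ K : ℕ, (∀ x : ℕ, 0 ≤ ∑ n ∈ Finset.Icc N₀ x, ∏ i ∈ T, Real.log ((((f i).eval (n : ℤ)).toNat : ℝ))) ∧
      (∀ x : ℕ, N₀ ≤ x → ∑ n ∈ Finset.Icc N₀ x, ∏ i ∈ T, Real.log ((((f i).eval (n : ℤ)).toNat : ℝ))
        ≤ (x : ℝ) * ((K : ℝ) * Real.log x) ^ T.card) ∧
      (∀ n : ℕ, 0 ≤ ∏ i ∈ T, Real.log ((((f i).eval (n : ℤ)).toNat : ℝ))) := by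
  obtain ⟨K, hKlog⟩ := signedTypeI_log_toNat_eval_le f
  have hWnn : ∀ n : ℕ, 0 ≤ ∏ i ∈ T, Real.log ((((f i).eval (n : ℤ)).toNat : ℝ)) := fun n =>
    Finset.prod_nonneg fun i _ => Real.log_natCast_nonneg _
  have hWmono : ∀ m n : ℕ, N₀ ≤ m → m ≤ n →
      ∏ i ∈ T, Real.log ((((f i).eval (m : ℤ)).toNat : ℝ)) ≤ ∏ i ∈ T, Real.log ((((f i).eval (n : ℤ)).toNat : ℝ)) := by
    intro m n hm hmn
    refine Finset.prod_le_prod (fun i _ => Real.log_natCast_nonneg _) fun i _ => ?_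
    refine Real.log_le_log (by exact_mod_cast (by linarith [h2 m hm i])) ?_
    exact_mod_cast Int.toNat_le_toNat (hmono i m n hm hmn)
  have hWle : ∀ n : ℕ, 2 ≤ n → ∏ i ∈ T, Real.log ((((f i).eval (n : ℤ)).toNat : ℝ)) ≤ ((K : ℝ) * Real.log n) ^ T.card := by
    intro n hn
    refine (Finset.prod_le_prod (fun i _ => Real.log_natCast_nonneg _) fun i _ => hKlog n hn i).trans_eq ?_
    rw [Finset.prod_const]
  refine ⟨K, fun x => Finset.sum_nonneg fun n _ => hWnn n, fun x hx => ?_, hWnn⟩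
  calc ∑ n ∈ Finset.Icc N₀ x, ∏ i ∈ T, Real.log ((((f i).eval (n : ℤ)).toNat : ℝ))
      ≤ ∑ n ∈ Finset.Icc N₀ x, ∏ i ∈ T, Real.log ((((f i).eval (x : ℤ)).toNat : ℝ)) :=
        Finset.sum_le_sum fun n hn => hWmono n x (mem_Icc.mp hn).1 (mem_Icc.mp hn).2
    _ = ((Finset.Icc N₀ x).card : ℝ) * ∏ i ∈ T, Real.log ((((f i).eval (x : ℤ)).toNat : ℝ)) := by
        rw [Finset.sum_const, nsmul_eq_mul]
    _ ≤ (x : ℝ) * ((K : ℝ) * Real.log x) ^ T.card := by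
        refine mul_le_mul ?_ (hWle x (by omega)) (hWnn x) (Nat.cast_nonneg x)
        rw [Nat.card_Icc]
        exact_mod_cast (by omega : x + 1 - N₀ ≤ x)

/-- The error sum `R(y) = Σ_{d ∈ box} μ²(d) #{…}` is non-negative. [folklore] -/
theorem errorSum_nonneg (y : ℝ) :
    0 ≤ ∑ d ∈ Fintype.piFinset (fun _ : Fin k => Finset.Icc 1 ⌊y⌋₊),
        (if ∏ i, (d i : ℝ) ≤ y then
          (∏ i, |(ArithmeticFunction.moebius (d i) : ℝ)|) *
            (((Finset.range (∏ i, d i)).filter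
                (fun n : ℕ => ∀ i, ((d i : ℕ) : ℤ) ∣ (f i).eval (n : ℤ))).card : ℝ)
        else 0) :=
  Finset.sum_nonneg fun d _ => by
    split_ifs
    · positivity
    · exact le_rfl

/-- For fixed `n`, the weighted truncated sum `W_T(n) P_T(n, y)` is bounded independently of `y`. [folklore] -/
theorem weighted_abs_le (n : ℕ) (y : ℝ) :
    |(∏ i ∈ T, Real.log ((((f i).eval (n : ℤ)).toNat : ℝ))) *
        ∑ d ∈ Fintype.piFinset (fun i => (((f i).eval (n : ℤ)).toNat).divisors),
          if ∏ i, (d i : ℝ) ≤ y then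
            (∏ i, (ArithmeticFunction.moebius (d i) : ℝ)) * ∏ i ∈ Finset.univ \ T, Real.log (d i)
          else 0|
      ≤ |∏ i ∈ T, Real.log ((((f i).eval (n : ℤ)).toNat : ℝ))| *
        ∑ d ∈ Fintype.piFinset (fun i => (((f i).eval (n : ℤ)).toNat).divisors),
          |(∏ i, (ArithmeticFunction.moebius (d i) : ℝ)) * ∏ i ∈ Finset.univ \ T, Real.log (d i)| := by
  rw [abs_mul]
  refine mul_le_mul_of_nonneg_left ?_ (abs_nonneg _)
  refine (Finset.abs_sum_le_sum_abs _ _).trans (Finset.sum_le_sum fun d _ => ?_)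
  split_ifs
  · exact le_rfl
  · rw [abs_zero]; exact abs_nonneg _

end PerT

/-- **Per-`T` estimate, `T ≠ ∅`.** -/
theorem perT_nonempty {k : ℕ} (f : Fin k → ℤ[X]) (hf : IsBatemanHornSystem f) {η : ℝ} (hη : 1 / 2 < η) (hη1 : η < 1)
    (T : Finset (Fin k)) (hT : T.Nonempty) {N₀ : ℕ} (hN₀3 : 3 ≤ N₀)
    (h2 : ∀ n : ℕ, N₀ ≤ n → ∀ i, 2 ≤ ((f i).eval (n : ℤ)).toNat)
    (hmono : ∀ i (m n : ℕ), N₀ ≤ m → m ≤ n → (f i).eval (m : ℤ) ≤ (f i).eval (n : ℤ)) :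
    (fun x : ℕ => (∑ n ∈ Finset.Icc N₀ x, (∏ i ∈ T, Real.log ((((f i).eval (n : ℤ)).toNat : ℝ))) *
        ∑ d ∈ Fintype.piFinset (fun i => (((f i).eval (n : ℤ)).toNat).divisors),
            if ∏ i, (d i : ℝ) ≤ (x : ℝ) / Real.log x ^ (2 * k + 2) then
              (∏ i, (ArithmeticFunction.moebius (d i) : ℝ)) * ∏ i ∈ Finset.univ \ T, Real.log (d i)
            else 0)
      - (∑ n ∈ Finset.Icc N₀ x, (∏ i ∈ T, Real.log ((((f i).eval (n : ℤ)).toNat : ℝ))) *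
        ∑ d ∈ Fintype.piFinset (fun i => (((f i).eval (n : ℤ)).toNat).divisors),
            if ∏ i, (d i : ℝ) ≤ (x : ℝ) ^ (1 - η) then
              (∏ i, (ArithmeticFunction.moebius (d i) : ℝ)) * ∏ i ∈ Finset.univ \ T, Real.log (d i)
            else 0))
      =o[atTop] fun x : ℕ => (x : ℝ) := by
  classical
  have hη0 : 0 < 1 - η := by linarith
  have hcardT : T.card + (univ \ T).card = k := by
    rw [Finset.card_sdiff_of_subset (Finset.subset_univ T), Finset.card_univ, Fintype.card_fin]
    have := T.card_le_univ; rw [Fintype.card_fin] at this; omega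
  obtain ⟨K, hX0, hXle, hWnn⟩ := weight_sum_le f T N₀ hN₀3 h2 hmono
  obtain ⟨C₁, hC₁⟩ := stub_strip_core k f T N₀ hN₀3 h2 hmono
  obtain ⟨C₂, hC₂⟩ := stub_tuple_rootCount_mean k f hf
  have hR0 := errorSum_nonneg f (k := k)
  have hev₂ := eventually_cutoff_facts (2 * k + 2)
  -- (1) the approximation error at the upper cut-off
  have hA2 := approx_isLittleO _ _ _ _ (fun x : ℕ => (x : ℝ) / Real.log x ^ (2 * k + 2)) hC₁ hC₂ hR0
    (by filter_upwards [hev₂] with x hx; exact hx.2.1)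
    (isLittleO_error_upper T.card (univ \ T).card k (2 * k + 2) (by omega))
  -- (2) the main term at the upper cut-off
  obtain ⟨CV, hCV⟩ := KernelTwoLe.kernel_of_stubs k f hf T hT
  have hM2 := main_upper_isLittleO _ _ (2 * k + 2) (Nat.cast_nonneg K) hX0 hXle hCV
  -- (3) the whole sum at the lower cut-off (landed signed Type-I bookkeeping + initial segment)
  have hfull := stub_signedTypeI_of_kernel KernelTwoLe.kernel_of_stubs k f hf η hη hη1 T hT
  have hM1 := tail_sum_isLittleO
    (fun (n : ℕ) (y : ℝ) => (∏ i ∈ T, Real.log ((((f i).eval (n : ℤ)).toNat : ℝ))) *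
        ∑ d ∈ Fintype.piFinset (fun i => (((f i).eval (n : ℤ)).toNat).divisors),
          if ∏ i, (d i : ℝ) ≤ y then
            (∏ i, (ArithmeticFunction.moebius (d i) : ℝ)) * ∏ i ∈ Finset.univ \ T, Real.log (d i)
          else 0)
    _ (fun x : ℕ => (x : ℝ) ^ (1 - η)) (by omega : 1 ≤ N₀) (fun n y => weighted_abs_le f T n y) hfull
  -- combine: `U₂ − U₁ = (U₂ − X V₂) + X V₂ − U₁`
  refine ((hA2.add hM2).sub hM1).congr' (Eventually.of_forall fun x => ?_) EventuallyEq.rfl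
  ring

/-- **Per-`T` estimate, `T = ∅`** (the log-weighted singular series converges). -/
theorem perT_empty {k : ℕ} (f : Fin k → ℤ[X]) (hf : IsBatemanHornSystem f) {η : ℝ} (hη : 1 / 2 < η) (hη1 : η < 1)
    {N₀ : ℕ} (hN₀3 : 3 ≤ N₀)
    (h2 : ∀ n : ℕ, N₀ ≤ n → ∀ i, 2 ≤ ((f i).eval (n : ℤ)).toNat)
    (hmono : ∀ i (m n : ℕ), N₀ ≤ m → m ≤ n → (f i).eval (m : ℤ) ≤ (f i).eval (n : ℤ)) :
    (fun x : ℕ => (∑ n ∈ Finset.Icc N₀ x, (∏ i ∈ (∅ : Finset (Fin k)), Real.log ((((f i).eval (n : ℤ)).toNat : ℝ))) *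
        ∑ d ∈ Fintype.piFinset (fun i => (((f i).eval (n : ℤ)).toNat).divisors),
            if ∏ i, (d i : ℝ) ≤ (x : ℝ) / Real.log x ^ (2 * k + 2) then
              (∏ i, (ArithmeticFunction.moebius (d i) : ℝ)) * ∏ i ∈ Finset.univ \ (∅ : Finset (Fin k)), Real.log (d i)
            else 0)
      - (∑ n ∈ Finset.Icc N₀ x, (∏ i ∈ (∅ : Finset (Fin k)), Real.log ((((f i).eval (n : ℤ)).toNat : ℝ))) *
        ∑ d ∈ Fintype.piFinset (fun i => (((f i).eval (n : ℤ)).toNat).divisors),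
            if ∏ i, (d i : ℝ) ≤ (x : ℝ) ^ (1 - η) then
              (∏ i, (ArithmeticFunction.moebius (d i) : ℝ)) * ∏ i ∈ Finset.univ \ (∅ : Finset (Fin k)), Real.log (d i)
            else 0))
      =o[atTop] fun x : ℕ => (x : ℝ) := by
  classical
  have hη0 : 0 < 1 - η := by linarith
  have hcard0 : (∅ : Finset (Fin k)).card + (univ \ (∅ : Finset (Fin k))).card = k := by
    rw [Finset.card_empty, Finset.sdiff_empty, Finset.card_univ, Fintype.card_fin, zero_add]
  obtain ⟨C₁, hC₁⟩ := stub_strip_core k f ∅ N₀ hN₀3 h2 hmono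
  obtain ⟨C₂, hC₂⟩ := stub_tuple_rootCount_mean k f hf
  have hR0 := errorSum_nonneg f (k := k)
  have hev₂ := eventually_cutoff_facts (2 * k + 2)
  have hy₁t : Tendsto (fun x : ℕ => (x : ℝ) ^ (1 - η)) atTop atTop :=
    (tendsto_rpow_atTop hη0).comp tendsto_natCast_atTop_atTop
  -- (1) the approximation errors at both cut-offs
  have hA2 := approx_isLittleO _ _ _ _ (fun x : ℕ => (x : ℝ) / Real.log x ^ (2 * k + 2)) hC₁ hC₂ hR0
    (by filter_upwards [hev₂] with x hx; exact hx.2.1)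
    (isLittleO_error_upper (∅ : Finset (Fin k)).card (univ \ (∅ : Finset (Fin k))).card k (2 * k + 2)
      (by omega))
  have hA1 := approx_isLittleO _ _ _ _ (fun x : ℕ => (x : ℝ) ^ (1 - η)) hC₁ hC₂ hR0
    (hy₁t.eventually_ge_atTop 2)
    (isLittleO_error_lower (∅ : Finset (Fin k)).card (univ \ (∅ : Finset (Fin k))).card k hη0 (by linarith))
  -- (2) the singular series: `V(y) = S(⌊y⌋)` converges
  have hρ : ∀ i p, p.Prime → polyRootCountMod ![f i] p < p := fun i p hp =>
    rootCount_member_lt f hf i hp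
  have hconv := tendsto_sum_coeff_univ_aFun f hf.irreducible hf.pairwise_not_associated
    (natDegree_member_pos f hf) hf.leadingCoeff_pos hρ
  set L : ℝ := (∑' n, SAlg.coeff (eFun f n) ∅) * ∏ i, (-batemanHornConst ![f i]) with hL
  set S : ℕ → ℝ := fun N => ∑ m ∈ Finset.Ioc 0 N, SAlg.coeff (aFun f m) Finset.univ with hS
  have hV : ∀ y : ℝ, 0 ≤ y →
      (∑ d ∈ Fintype.piFinset (fun _ : Fin k => Finset.Icc 1 ⌊y⌋₊),
        if ∏ i, (d i : ℝ) ≤ y then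
          (∏ i, (ArithmeticFunction.moebius (d i) : ℝ)) * (∏ i ∈ Finset.univ \ (∅ : Finset (Fin k)), Real.log (d i)) *
            ((((Finset.range (∏ i, d i)).filter
                (fun n : ℕ => ∀ i, ((d i : ℕ) : ℤ) ∣ (f i).eval (n : ℤ))).card : ℝ) / ∏ i, (d i : ℝ))
        else 0) = S ⌊y⌋₊ := by
    intro y hy
    rw [stub_kernel_sum_eq k f ∅ y hy, hS]
    simp only [Finset.sdiff_empty]
  have hy2_0 : ∀ x : ℕ, (0 : ℝ) ≤ (x : ℝ) / Real.log x ^ (2 * k + 2) := fun x => by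
    rcases Nat.eq_zero_or_pos x with rfl | hx
    · simp
    · exact div_nonneg (Nat.cast_nonneg x) (pow_nonneg (Real.log_natCast_nonneg x) _)
  have hy1_0 : ∀ x : ℕ, (0 : ℝ) ≤ (x : ℝ) ^ (1 - η) := fun x => Real.rpow_nonneg (Nat.cast_nonneg x) _
  have hy2t : Tendsto (fun x : ℕ => (x : ℝ) / Real.log x ^ (2 * k + 2)) atTop atTop := by
    refine tendsto_atTop_mono' atTop ?_
      ((tendsto_rpow_atTop (by norm_num : (0 : ℝ) < 1 / 2)).comp tendsto_natCast_atTop_atTop)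
    filter_upwards [hev₂, eventually_ge_atTop 1] with x hx hx1
    obtain ⟨-, hy2, -, hlog2⟩ := hx
    have hx0 : (0 : ℝ) < x := by exact_mod_cast hx1
    have hy0 : 0 < (x : ℝ) / Real.log x ^ (2 * k + 2) := by linarith
    have h : Real.log ((x : ℝ) ^ (1 / 2 : ℝ)) ≤ Real.log ((x : ℝ) / Real.log x ^ (2 * k + 2)) := by
      rw [Real.log_rpow hx0]; linarith
    simp only [Function.comp_apply]
    exact (Real.log_le_log_iff (Real.rpow_pos_of_pos hx0 _) hy0).mp h
  have hSup : Tendsto (fun x : ℕ => S ⌊(x : ℝ) / Real.log x ^ (2 * k + 2)⌋₊) atTop (𝓝 L) :=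
    hconv.comp (tendsto_nat_floor_atTop.comp hy2t)
  have hSlow : Tendsto (fun x : ℕ => S ⌊(x : ℝ) ^ (1 - η)⌋₊) atTop (𝓝 L) :=
    hconv.comp (tendsto_nat_floor_atTop.comp hy₁t)
  have hg : Tendsto (fun x : ℕ => S ⌊(x : ℝ) / Real.log x ^ (2 * k + 2)⌋₊ - S ⌊(x : ℝ) ^ (1 - η)⌋₊)
      atTop (𝓝 0) := by
    have := hSup.sub hSlow
    rwa [sub_self] at this
  have hE := card_mul_tendsto_zero_isLittleO _ N₀ hg
  -- (3) `X_∅(x) = x + 1 − N₀`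
  have hXcard : ∀ x : ℕ, (∑ n ∈ Finset.Icc N₀ x,
      ∏ i ∈ (∅ : Finset (Fin k)), Real.log ((((f i).eval (n : ℤ)).toNat : ℝ))) = ((x + 1 - N₀ : ℕ) : ℝ) := by
    intro x
    simp [Finset.sum_const, Nat.card_Icc]
  -- combine
  refine ((hA2.sub hA1).add hE).congr' (Eventually.of_forall fun x => ?_) EventuallyEq.rfl
  dsimp only
  rw [hV _ (hy2_0 x), hV _ (hy1_0 x), hXcard x]
  ring

/-! ### The strip -/

/-- **The strip from the stubs** (every `k`): for a Bateman–Horn system and `η ∈ (1/2, 1)` the natural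
tail between the cut-offs `x^{1-η}` and `x/(log x)^{2k+2}` sums to `o(x)`. -/
theorem strip_of_stubs :
    ∀ (k : ℕ) (f : Fin k → ℤ[X]),
    Literature.NumberTheory.Sieve.IsBatemanHornSystem f → ∀ η : ℝ, 1 / 2 < η → η < 1 →
      (fun x : ℕ => ∑ n ∈ Finset.Icc 1 x,
        ((∑ d ∈ Fintype.piFinset (fun i => (((f i).eval (n : ℤ)).toNat).divisors),
            if (x : ℝ) ^ (1 - η) < ∏ i, (d i : ℝ) then
              ∏ i, ((ArithmeticFunction.moebius (d i) : ℝ) *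
                Real.log ((((f i).eval (n : ℤ)).toNat : ℝ) / (d i : ℝ))) else 0)
        - (∑ d ∈ Fintype.piFinset (fun i => (((f i).eval (n : ℤ)).toNat).divisors),
            if (x : ℝ) / Real.log x ^ (2 * k + 2) < ∏ i, (d i : ℝ) then
              ∏ i, ((ArithmeticFunction.moebius (d i) : ℝ) *
                Real.log ((((f i).eval (n : ℤ)).toNat : ℝ) / (d i : ℝ))) else 0)))
        =o[atTop] fun x : ℕ => (x : ℝ) := by
  intro k f hf η hη hη1
  classical
  obtain ⟨N₀, hN₀3, h2, hmono⟩ := signedTypeI_threshold hf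
  -- (1) every `T`-term is `o(x)`, hence so is their signed sum
  have hmain : (fun x : ℕ => ∑ T ∈ (Finset.univ : Finset (Fin k)).powerset,
      (-1 : ℝ) ^ (Finset.univ \ T).card *
        ((∑ n ∈ Finset.Icc N₀ x, (∏ i ∈ T, Real.log ((((f i).eval (n : ℤ)).toNat : ℝ))) *
            ∑ d ∈ Fintype.piFinset (fun i => (((f i).eval (n : ℤ)).toNat).divisors),
              if ∏ i, (d i : ℝ) ≤ (x : ℝ) / Real.log x ^ (2 * k + 2) then
                (∏ i, (ArithmeticFunction.moebius (d i) : ℝ)) * ∏ i ∈ Finset.univ \ T, Real.log (d i)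
              else 0)
        - (∑ n ∈ Finset.Icc N₀ x, (∏ i ∈ T, Real.log ((((f i).eval (n : ℤ)).toNat : ℝ))) *
            ∑ d ∈ Fintype.piFinset (fun i => (((f i).eval (n : ℤ)).toNat).divisors),
              if ∏ i, (d i : ℝ) ≤ (x : ℝ) ^ (1 - η) then
                (∏ i, (ArithmeticFunction.moebius (d i) : ℝ)) * ∏ i ∈ Finset.univ \ T, Real.log (d i)
              else 0)))
      =o[atTop] fun x : ℕ => (x : ℝ) :=
    IsLittleO.sum fun T _ => by
      rcases T.eq_empty_or_nonempty with hT | hT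
      · subst hT; exact (perT_empty f hf hη hη1 hN₀3 h2 hmono).const_mul_left _
      · exact (perT_nonempty f hf hη hη1 T hT hN₀3 h2 hmono).const_mul_left _
  -- (2) the initial segment `n < N₀` is bounded
  have hinit : (fun x : ℕ => ∑ n ∈ (Finset.Icc 1 x).filter (fun n => n < N₀),
      ((∑ d ∈ Fintype.piFinset (fun i => (((f i).eval (n : ℤ)).toNat).divisors),
          if (x : ℝ) ^ (1 - η) < ∏ i, (d i : ℝ) then
            ∏ i, ((ArithmeticFunction.moebius (d i) : ℝ) *
              Real.log ((((f i).eval (n : ℤ)).toNat : ℝ) / (d i : ℝ))) else 0)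
      - (∑ d ∈ Fintype.piFinset (fun i => (((f i).eval (n : ℤ)).toNat).divisors),
          if (x : ℝ) / Real.log x ^ (2 * k + 2) < ∏ i, (d i : ℝ) then
            ∏ i, ((ArithmeticFunction.moebius (d i) : ℝ) *
              Real.log ((((f i).eval (n : ℤ)).toNat : ℝ) / (d i : ℝ))) else 0)))
      =o[atTop] fun x : ℕ => (x : ℝ) := by
    set G : ℕ → ℝ := fun n => 2 * ∑ d ∈ Fintype.piFinset (fun i => (((f i).eval (n : ℤ)).toNat).divisors),
      |∏ i, ((ArithmeticFunction.moebius (d i) : ℝ) *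
        Real.log ((((f i).eval (n : ℤ)).toNat : ℝ) / (d i : ℝ)))| with hG
    have hB : (fun x : ℕ => ∑ n ∈ (Finset.Icc 1 x).filter (fun n => n < N₀),
        ((∑ d ∈ Fintype.piFinset (fun i => (((f i).eval (n : ℤ)).toNat).divisors),
            if (x : ℝ) ^ (1 - η) < ∏ i, (d i : ℝ) then
              ∏ i, ((ArithmeticFunction.moebius (d i) : ℝ) *
                Real.log ((((f i).eval (n : ℤ)).toNat : ℝ) / (d i : ℝ))) else 0)
        - (∑ d ∈ Fintype.piFinset (fun i => (((f i).eval (n : ℤ)).toNat).divisors),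
            if (x : ℝ) / Real.log x ^ (2 * k + 2) < ∏ i, (d i : ℝ) then
              ∏ i, ((ArithmeticFunction.moebius (d i) : ℝ) *
                Real.log ((((f i).eval (n : ℤ)).toNat : ℝ) / (d i : ℝ))) else 0)))
        =O[atTop] fun _ : ℕ => (1 : ℝ) := by
      refine IsBigO.of_bound (∑ n ∈ Finset.range N₀, G n) (Eventually.of_forall fun x => ?_)
      rw [Real.norm_eq_abs, norm_one, mul_one]
      refine signedTypeI_initial_le (fun (n : ℕ) (t : ℝ) =>
        (∑ d ∈ Fintype.piFinset (fun i => (((f i).eval (n : ℤ)).toNat).divisors),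
            if t ^ (1 - η) < ∏ i, (d i : ℝ) then
              ∏ i, ((ArithmeticFunction.moebius (d i) : ℝ) *
                Real.log ((((f i).eval (n : ℤ)).toNat : ℝ) / (d i : ℝ))) else 0)
        - (∑ d ∈ Fintype.piFinset (fun i => (((f i).eval (n : ℤ)).toNat).divisors),
            if t / Real.log t ^ (2 * k + 2) < ∏ i, (d i : ℝ) then
              ∏ i, ((ArithmeticFunction.moebius (d i) : ℝ) *
                Real.log ((((f i).eval (n : ℤ)).toNat : ℝ) / (d i : ℝ))) else 0)) G ?_ N₀ x (x : ℝ)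
      intro n t
      have hA : ∀ s : ℝ, |∑ d ∈ Fintype.piFinset (fun i => (((f i).eval (n : ℤ)).toNat).divisors),
          (if s < ∏ i, (d i : ℝ) then
            ∏ i, ((ArithmeticFunction.moebius (d i) : ℝ) *
              Real.log ((((f i).eval (n : ℤ)).toNat : ℝ) / (d i : ℝ))) else 0)|
          ≤ ∑ d ∈ Fintype.piFinset (fun i => (((f i).eval (n : ℤ)).toNat).divisors),
            |∏ i, ((ArithmeticFunction.moebius (d i) : ℝ) *
              Real.log ((((f i).eval (n : ℤ)).toNat : ℝ) / (d i : ℝ)))| := by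
        intro s
        refine (Finset.abs_sum_le_sum_abs _ _).trans (Finset.sum_le_sum fun d _ => ?_)
        split_ifs
        · exact le_rfl
        · rw [abs_zero]; exact abs_nonneg _
      calc _ ≤ _ := abs_sub _ _
        _ ≤ _ := add_le_add (hA _) (hA _)
        _ = G n := by rw [hG]; ring
    refine hB.trans_isLittleO ?_
    exact isLittleO_const_left.2 (Or.inr (tendsto_norm_atTop_atTop.comp tendsto_natCast_atTop_atTop))
  -- (3) the identity, for `x ≥ N₀`
  refine (hinit.add hmain).congr' ?_ EventuallyEq.rfl
  filter_upwards [eventually_ge_atTop N₀] with x hx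
  rw [← Finset.sum_filter_add_sum_filter_not (Finset.Icc 1 x) (fun n => n < N₀)]
  congr 1
  have hIcc : (Finset.Icc 1 x).filter (fun n => ¬n < N₀) = Finset.Icc N₀ x := by
    ext n
    simp only [Finset.mem_filter, Finset.mem_Icc, not_lt]
    omega
  rw [hIcc]
  symm
  -- expand each `n ≥ N₀` and swap the sums
  have hn : ∀ n ∈ Finset.Icc N₀ x, ∀ y : ℝ,
      (∑ d ∈ Fintype.piFinset (fun i => (((f i).eval (n : ℤ)).toNat).divisors),
          if y < ∏ i, (d i : ℝ) then
            ∏ i, ((ArithmeticFunction.moebius (d i) : ℝ) *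
              Real.log ((((f i).eval (n : ℤ)).toNat : ℝ) / (d i : ℝ))) else 0)
        = (∑ d ∈ Fintype.piFinset (fun i => (((f i).eval (n : ℤ)).toNat).divisors),
            ∏ i, ((ArithmeticFunction.moebius (d i) : ℝ) *
              Real.log ((((f i).eval (n : ℤ)).toNat : ℝ) / (d i : ℝ))))
          - ∑ T ∈ (Finset.univ : Finset (Fin k)).powerset,
            (-1 : ℝ) ^ (Finset.univ \ T).card *
              ((∏ i ∈ T, Real.log ((((f i).eval (n : ℤ)).toNat : ℝ))) *
                ∑ d ∈ Fintype.piFinset (fun i => (((f i).eval (n : ℤ)).toNat).divisors),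
                  if ∏ i, (d i : ℝ) ≤ y then
                    (∏ i, (ArithmeticFunction.moebius (d i) : ℝ)) * ∏ i ∈ Finset.univ \ T, Real.log (d i)
                  else 0) := by
    intro n _ y
    rw [sum_ite_lt_eq_sub, truncated_natural_expand (fun i => ((f i).eval (n : ℤ)).toNat) y]
  rw [Finset.sum_congr rfl fun n hn' => by
    rw [hn n hn' ((x : ℝ) ^ (1 - η)), hn n hn' ((x : ℝ) / Real.log x ^ (2 * k + 2))]]
  -- now both sides are finite sums; rearrange
  simp only [sub_sub_sub_cancel_left]
  rw [Finset.sum_congr rfl fun n _ => by rw [← Finset.sum_sub_distrib], Finset.sum_comm]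
  refine Finset.sum_congr rfl fun T _ => ?_
  rw [Finset.sum_congr rfl fun n _ => by rw [← mul_sub], ← Finset.mul_sum, Finset.sum_sub_distrib]

end StripTwoLe

/-- **Stub `stub_strip_two_le`** (registered, skeleton v6 of line `Sketch`): for `k ≥ 2`, a Bateman–Horn system
`f` and `η ∈ (1/2, 1)`, the natural tail between the cut-offs `x^{1-η}` and `x/(log x)^{2k+2}` sums to `o(x)`. [folklore] -/
theorem stub_strip_two_le : ∀ (k : ℕ), 2 ≤ k → ∀ (f : Fin k → ℤ[X]),
    Literature.NumberTheory.Sieve.IsBatemanHornSystem f → ∀ η : ℝ, 1 / 2 < η → η < 1 →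
      (fun x : ℕ => ∑ n ∈ Finset.Icc 1 x,
        ((∑ d ∈ Fintype.piFinset (fun i => (((f i).eval (n : ℤ)).toNat).divisors),
            if (x : ℝ) ^ (1 - η) < ∏ i, (d i : ℝ) then
              ∏ i, ((ArithmeticFunction.moebius (d i) : ℝ) *
                Real.log ((((f i).eval (n : ℤ)).toNat : ℝ) / (d i : ℝ))) else 0)
        - (∑ d ∈ Fintype.piFinset (fun i => (((f i).eval (n : ℤ)).toNat).divisors),
            if (x : ℝ) / Real.log x ^ (2 * k + 2) < ∏ i, (d i : ℝ) then
              ∏ i, ((ArithmeticFunction.moebius (d i) : ℝ) *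
                Real.log ((((f i).eval (n : ℤ)).toNat : ℝ) / (d i : ℝ))) else 0)))
        =o[atTop] fun x : ℕ => (x : ℝ) :=
  fun k _ f hf η hη hη1 => StripTwoLe.strip_of_stubs k f hf η hη hη1

end Summit.Parity.BatemanHorn.Theorems.PolyMobiusTail.NaturalForm
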